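import Literature.Combinatorics.SimpleGraph.ListTreeDecompositionSeparators
import Literature.Combinatorics.SimpleGraph.TreeDecompositionRooting
import Mathlib.Algebra.Order.BigOperators.Group.Finset
import Mathlib.Data.Fintype.Card
import HarnessLib

/-!
# Chunks of prescribed size with a small separator, from a tree decomposition

Topic `Literature/Combinatorics/SimpleGraph`, sequel of `ListTreeDecompositionSeparators.lean`
(Robertson–Seymour balanced separators from a rooted tree decomposition in list form) and
`TreeDecompositionRooting.lean` (every tree decomposition can be rooted and listed). The standard
consequence of small treewidth used for LOWER bounds: a graph of treewidth `≤ k` on more than `r`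
vertices, `r ≥ 2(k + 1)`, has a vertex set `F` with `r/2 ≤ |F| ≤ r` all of whose outside
neighbours lie in one bag (so at most `k + 1` of them). Proof: take a deepest node `t` whose
"private part" `V_t` (the vertices below `t` not in the parent bag) has `≥ r/2` vertices; either
`|V_t| ≤ r` and `F := V_t` is separated by the parent bag, or the parts strictly below the children
of `t` — each of size `< r/2`, pairwise disjoint, jointly of size `> r - (k + 1) ≥ r/2`, and each
separated by `bag t` — have an initial segment of total size in `[r/2, r)`.

* `ListTD.exists_chunk` — the list form (rooted decomposition `IsRootedTDOn S par bags` covering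
  the edges of a symmetric relation `E` inside `S`, bags of size `≤ k + 1`);
* `exists_chunk_of_treewidth_le` — the same for `treewidth G ≤ k` of a finite simple graph.

Expanders therefore have linear treewidth (a set of `≤ r` vertices with few outside neighbours
contradicts expansion); see `Literature.Computability.MetaComplexity` for the boundary-expander
form used in proof complexity.

## References

* N. Robertson, P. D. Seymour, *Graph minors. II. Algorithmic aspects of tree-width*,
  J. Algorithms 7 (1986) 309–322, (2.5)–(2.6) (separators of size `≤ k + 1` cutting off a
  prescribed weight) [RobertsonSeymour1986].
* M. Cygan et al., *Parameterized Algorithms*, Springer 2015, Lemma 7.19–7.20 (the rooted form of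
  the argument: a deepest node below which half the weight occurs) [CyganEtAl2015].
-/

namespace Literature.Combinatorics.SimpleGraph

namespace ListTD

open Finset

variable {S : Finset ℕ} {par : List ℕ} {bags : List (List ℕ)} {E : ℕ → ℕ → Prop}

/-- The part strictly below a child `c` of `t` is one of the parts at `t`. [folklore] -/
theorem partBelow_mem_parts {t c : ℕ} (hc : c ∈ kids par bags t) :
    partBelow par bags t c ∈ parts S par bags t :=
  List.mem_cons_of_mem _ (List.mem_map_of_mem hc)

/-- Parts below distinct children of `t` are disjoint. [cite: CyganEtAl2015, Lemma 7.3] -/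
theorem disjoint_partBelow (hD : IsRootedTDOn S par bags) {t c c' : ℕ} (hc : c ∈ kids par bags t)
    (hc' : c' ∈ kids par bags t) (hcc' : c ≠ c') :
    Disjoint (partBelow par bags t c) (partBelow par bags t c') := by
  obtain ⟨-, hc0, hpc⟩ := mem_kids.1 hc
  obtain ⟨-, hc'0, hpc'⟩ := mem_kids.1 hc'
  rw [Finset.disjoint_left]
  intro v hv hv'
  have := mem_bagOf_of_below_of_below hD hc0 hc'0 hcc' hpc hpc' (Finset.mem_sdiff.1 hv).1
    (Finset.mem_sdiff.1 hv').1
  exact (Finset.mem_sdiff.1 hv).2 (by simpa using this)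

/-- **A vertex below `t` outside `bag t` lies strictly below a child of `t`.**
[cite: CyganEtAl2015, §7.2] -/
theorem exists_mem_partBelow (hD : IsRootedTDOn S par bags) {v t : ℕ} (hv : v ∈ below par bags t)
    (hvt : v ∉ bagOf bags t) : ∃ c ∈ kids par bags t, v ∈ partBelow par bags t c := by
  obtain ⟨c, hc0, -, hpc, hvc⟩ := exists_child_of_mem_below hv hvt
  obtain ⟨s, hs, hcs, -⟩ := mem_below.1 hvc
  exact ⟨c, mem_kids.2 ⟨(hcs.le hD).trans_lt hs, hc0, hpc⟩,
    Finset.mem_sdiff.2 ⟨hvc, by simpa using hvt⟩⟩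

/-- **Shortest prefix reaching a threshold.** For natural weights `w 0, …, w (len - 1)` with
`2 · w i < r` for every `i < len` and `r ≤ 2 · Σ_{i < len} w i`, some prefix sum
`P j = Σ_{i < j} w i` (`j ≤ len`) satisfies `r ≤ 2 P j` and `P j ≤ r`: the shortest prefix reaching
`r / 2` overshoots by less than `r / 2`. [folklore] -/
theorem exists_prefix_sum_mem_Icc (w : ℕ → ℕ) (len r : ℕ) (hw : ∀ i, i < len → 2 * w i < r)
    (hsum : r ≤ 2 * ∑ i ∈ Finset.range len, w i) :
    ∃ j, j ≤ len ∧ r ≤ 2 * ∑ i ∈ Finset.range j, w i ∧ ∑ i ∈ Finset.range j, w i ≤ r := by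
  have hP : ∃ j, j ≤ len ∧ r ≤ 2 * ∑ i ∈ Finset.range j, w i := ⟨len, le_rfl, hsum⟩
  refine ⟨Nat.find hP, (Nat.find_spec hP).1, (Nat.find_spec hP).2, ?_⟩
  rcases Nat.eq_zero_or_pos (Nat.find hP) with h0 | hpos
  · rw [h0]; simp
  · obtain ⟨j, hj⟩ := Nat.exists_eq_succ_of_ne_zero hpos.ne'
    have hmin : ¬ (j ≤ len ∧ r ≤ 2 * ∑ i ∈ Finset.range j, w i) := Nat.find_min hP (by omega)
    have hjlen : j < len := by have := (Nat.find_spec hP).1; omega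
    have hlt : 2 * ∑ i ∈ Finset.range j, w i < r := by
      by_contra hc; exact hmin ⟨hjlen.le, not_lt.1 hc⟩
    rw [hj, Finset.sum_range_succ]
    have := hw j hjlen
    omega

/-- **A chunk of prescribed size with a bag as separator** (list form). Given a rooted tree
decomposition of `S` covering the edges of the symmetric relation `E` inside `S`, with all bags of
size `≤ k + 1`, and `2(k + 1) ≤ r < |S|`, there are `F ⊆ S` and a node `t` such that
`r ≤ 2|F|`, `|F| ≤ r`, `F` avoids `bag t`, and every neighbour in `S` of a vertex of `F` lies in
`F` or in `bag t`. [cite: RobertsonSeymour1986, (2.5)–(2.6)] -/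
theorem exists_chunk (hD : IsRootedTDOn S par bags) (hE : ∀ u v, E u v → E v u)
    (hT2 : CoversEdges S E bags) {k r : ℕ}
    (hk : ∀ t, t < bags.length → (bagOf bags t).length ≤ k + 1) (hkr : 2 * (k + 1) ≤ r)
    (hrS : r < S.card) :
    ∃ F ⊆ S, ∃ t, t < bags.length ∧ Disjoint F (bagOf bags t).toFinset ∧ r ≤ 2 * F.card ∧
      F.card ≤ r ∧ ∀ u ∈ F, ∀ v ∈ S, E u v → v ∉ bagOf bags t → v ∈ F := by
  classical
  -- the private part of a node: below it, outside the parent bag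
  set A : ℕ → Finset ℕ := fun t => below par bags t \ (bagOf bags (pr par t)).toFinset with hA
  have hbag : ∀ t, ((bagOf bags t).toFinset).card ≤ k + 1 := by
    intro t
    by_cases ht : t < bags.length
    · exact (List.toFinset_card_le _).trans (hk t ht)
    · rw [bagOf_eq_nil (not_lt.1 ht)]; simp
  -- the deepest node with a large private part
  set T : Finset ℕ := (Finset.range bags.length).filter fun t => r ≤ 2 * (A t).card with hT
  have h0T : 0 ∈ T := by
    refine Finset.mem_filter.2 ⟨Finset.mem_range.2 hD.pos, ?_⟩
    have hA0 : A 0 = S \ (bagOf bags 0).toFinset := by simp [hA, below_zero hD]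
    have h1 : S.card ≤ (A 0).card + ((bagOf bags 0).toFinset).card := by
      rw [hA0]; exact Finset.card_le_card_sdiff_add_card
    have h2 := hbag 0
    omega
  set t := T.max' ⟨0, h0T⟩ with ht
  have htT : t ∈ T := Finset.max'_mem T ⟨0, h0T⟩
  obtain ⟨htlen, htA⟩ : t < bags.length ∧ r ≤ 2 * (A t).card := by simpa [hT] using htT
  have hmax : ∀ c, t < c → c < bags.length → 2 * (A c).card < r := by
    intro c htc hc
    by_contra hcon
    have hcT : c ∈ T := Finset.mem_filter.2 ⟨Finset.mem_range.2 hc, not_lt.1 hcon⟩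
    have := Finset.le_max' T c hcT
    rw [← ht] at this
    omega
  by_cases hsmall : (A t).card ≤ r
  · -- Case A: the private part of `t` itself, separated by the parent bag
    refine ⟨A t, fun v hv => below_subset hD t (Finset.mem_sdiff.1 hv).1, pr par t,
      (pr_le hD t).trans_lt htlen, Finset.sdiff_disjoint, htA, hsmall, ?_⟩
    intro u hu v hv huv hvb
    obtain ⟨hub, hux⟩ := Finset.mem_sdiff.1 hu
    refine Finset.mem_sdiff.2 ⟨mem_below_of_adj hD hT2 hub (by simpa using hux) hv huv, ?_⟩
    simpa using hvb
  · -- Case B: an initial segment of the parts below the children of `t`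
    push Not at hsmall
    set K := kids par bags t with hK
    set w : ℕ → ℕ := fun i => (partBelow par bags t (K.getD i 0)).card with hw
    have hKi : ∀ i, i < K.length → K.getD i 0 ∈ K := fun i hi => by
      rw [List.getD_eq_getElem?_getD, List.getElem?_eq_getElem hi]; exact List.getElem_mem hi
    -- each child part is small: children come after `t`
    have hwsmall : ∀ i, i < K.length → 2 * w i < r := by
      intro i hi
      obtain ⟨hclen, hc0, hpc⟩ := mem_kids.1 (hKi i hi)
      have htc : t < K.getD i 0 := by
        have := pr_lt hD hc0; rw [hpc] at this; exact this
      have hAc : A (K.getD i 0) = partBelow par bags t (K.getD i 0) := by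
        simp only [hA, partBelow, hpc]
      have := hmax _ htc hclen
      rw [hAc] at this
      exact this
    -- the child parts are pairwise disjoint
    have hdisj : ∀ I : Finset ℕ, I ⊆ Finset.range K.length →
        (I : Set ℕ).PairwiseDisjoint fun i => partBelow par bags t (K.getD i 0) := by
      intro I hI i hi j hj hij
      have hi' := Finset.mem_range.1 (hI hi)
      have hj' := Finset.mem_range.1 (hI hj)
      refine disjoint_partBelow hD (hKi i hi') (hKi j hj') fun h => hij ?_
      rw [List.getD_eq_getElem?_getD, List.getElem?_eq_getElem hi', Option.getD_some,
        List.getD_eq_getElem?_getD, List.getElem?_eq_getElem hj', Option.getD_some] at h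
      exact (nodup_kids (par := par) (bags := bags) t).getElem_inj_iff.1 h
    -- together they carry the private part of `t` outside `bag t`, hence `> r - (k+1)` vertices
    have hcover : A t \ (bagOf bags t).toFinset ⊆
        (Finset.range K.length).biUnion fun i => partBelow par bags t (K.getD i 0) := by
      intro v hv
      obtain ⟨hvA, hvt⟩ := Finset.mem_sdiff.1 hv
      obtain ⟨c, hc, hvc⟩ := exists_mem_partBelow hD (Finset.mem_sdiff.1 hvA).1 (by simpa using hvt)
      obtain ⟨i, hi, rfl⟩ := List.mem_iff_getElem.1 hc
      refine Finset.mem_biUnion.2 ⟨i, Finset.mem_range.2 hi, ?_⟩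
      rwa [List.getD_eq_getElem?_getD, List.getElem?_eq_getElem hi, Option.getD_some]
    have hsum : r ≤ 2 * ∑ i ∈ Finset.range K.length, w i := by
      have h1 : (A t).card ≤ (A t \ (bagOf bags t).toFinset).card + ((bagOf bags t).toFinset).card :=
        Finset.card_le_card_sdiff_add_card
      have h2 : (A t \ (bagOf bags t).toFinset).card ≤ ∑ i ∈ Finset.range K.length, w i := by
        calc (A t \ (bagOf bags t).toFinset).card
            ≤ ((Finset.range K.length).biUnion fun i => partBelow par bags t (K.getD i 0)).card :=
              Finset.card_le_card hcover
          _ = ∑ i ∈ Finset.range K.length, w i := Finset.card_biUnion (hdisj _ subset_rfl)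
      have h3 := hbag t
      omega
    obtain ⟨j, hjlen, hjlo, hjhi⟩ := exists_prefix_sum_mem_Icc w K.length r hwsmall hsum
    set F := (Finset.range j).biUnion fun i => partBelow par bags t (K.getD i 0) with hF
    have hFcard : F.card = ∑ i ∈ Finset.range j, w i :=
      Finset.card_biUnion (hdisj _ (Finset.range_subset_range.2 hjlen))
    refine ⟨F, ?_, t, htlen, ?_, by rw [hFcard]; exact hjlo, by rw [hFcard]; exact hjhi, ?_⟩
    · intro v hv
      obtain ⟨i, -, hvi⟩ := Finset.mem_biUnion.1 hv
      exact below_subset hD _ (Finset.mem_sdiff.1 hvi).1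
    · rw [hF, Finset.disjoint_biUnion_left]
      intro i _
      exact Finset.sdiff_disjoint
    · intro u hu v hv huv hvt
      obtain ⟨i, hi, hui⟩ := Finset.mem_biUnion.1 hu
      have hi' : i < K.length := (Finset.mem_range.1 hi).trans_le hjlen
      have hvi : v ∈ partBelow par bags t (K.getD i 0) :=
        mem_part_of_adj hD hE hT2 (partBelow_mem_parts (hKi i hi')) hui hv huv hvt
      exact Finset.mem_biUnion.2 ⟨i, hi, hvi⟩

end ListTD

/-! ### The abstract form -/

section Treewidth

open _root_.SimpleGraph ListTD

variable {V : Type*} [Fintype V]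

/-- **A chunk of prescribed size with a small separator, from small treewidth.** If a finite
simple graph `G` has treewidth `≤ k` and `2(k + 1) ≤ r < |V|`, there are disjoint vertex sets `F`
and `B` with `|B| ≤ k + 1`, `r ≤ 2|F|`, `|F| ≤ r`, such that every neighbour of a vertex of `F`
lies in `F` or in `B` (`B` is a bag of an optimal tree decomposition).
[cite: RobertsonSeymour1986, (2.5)–(2.6)] -/
theorem exists_chunk_of_treewidth_le (G : _root_.SimpleGraph V) {k r : ℕ} (hk : treewidth G ≤ k)
    (hkr : 2 * (k + 1) ≤ r) (hr : r < Fintype.card V) :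
    ∃ F B : Finset V, B.card ≤ k + 1 ∧ Disjoint F B ∧ r ≤ 2 * F.card ∧ F.card ≤ r ∧
      ∀ u ∈ F, ∀ v, G.Adj u v → v ∈ F ∨ v ∈ B := by
  classical
  set n := Fintype.card V with hn
  set e : V ≃ Fin n := Fintype.equivFin V with he
  obtain ⟨par, bags, hD, hT2, hbags⟩ := exists_isRootedTD_of_treewidth_le e hk
  -- the edge relation on the vertex numbers
  set E : ℕ → ℕ → Prop := fun a b => ∃ u v, G.Adj u v ∧ ((e u : Fin n) : ℕ) = a ∧
    ((e v : Fin n) : ℕ) = b with hE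
  have hEsymm : ∀ a b, E a b → E b a := by
    rintro a b ⟨u, v, huv, rfl, rfl⟩
    exact ⟨v, u, huv.symm, rfl, rfl⟩
  have hcov : CoversEdges (Finset.range n) E bags := by
    rintro a - b - ⟨u, v, huv, rfl, rfl⟩
    exact hT2 u v huv
  have hcard : r < (Finset.range n).card := by rwa [Finset.card_range]
  obtain ⟨F', hF'S, t, -, hdisj, hlo, hhi, hcl⟩ := exists_chunk hD hEsymm hcov hbags hkr hcard
  -- pull the sets back to `V`
  set f : V → ℕ := fun v => ((e v : Fin n) : ℕ) with hf
  have hfinj : Function.Injective f := fun u v h => e.injective (Fin.ext h)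
  set F : Finset V := Finset.univ.filter fun v => f v ∈ F' with hF
  set B : Finset V := Finset.univ.filter fun v => f v ∈ (bagOf bags t).toFinset with hB
  -- `F'` consists of vertex numbers, so `F` has the same size
  have hFcard : F.card = F'.card := by
    have himage : F.image f = F' := by
      ext a
      simp only [Finset.mem_image, hF, Finset.mem_filter, Finset.mem_univ, true_and]
      constructor
      · rintro ⟨v, hv, rfl⟩; exact hv
      · intro ha
        have han : a < n := Finset.mem_range.1 (hF'S ha)
        refine ⟨e.symm ⟨a, han⟩, ?_, ?_⟩ <;> simp [hf, ha]
    rw [← himage, Finset.card_image_of_injective _ hfinj]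
  have hBcard : B.card ≤ k + 1 := by
    calc B.card = (B.image f).card := (Finset.card_image_of_injective _ hfinj).symm
      _ ≤ ((bagOf bags t).toFinset).card := by
          refine Finset.card_le_card fun a ha => ?_
          obtain ⟨v, hv, rfl⟩ := Finset.mem_image.1 ha
          exact (Finset.mem_filter.1 hv).2
      _ ≤ (bagOf bags t).length := List.toFinset_card_le _
      _ ≤ k + 1 := by
          by_cases ht : t < bags.length
          · exact hbags t ht
          · rw [bagOf_eq_nil (not_lt.1 ht)]; simp
  refine ⟨F, B, hBcard, ?_, by rw [hFcard]; exact hlo, by rw [hFcard]; exact hhi, ?_⟩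
  · rw [Finset.disjoint_left]
    intro v hvF hvB
    exact Finset.disjoint_left.1 hdisj (Finset.mem_filter.1 hvF).2 (Finset.mem_filter.1 hvB).2
  · intro u hu v huv
    have hu' : f u ∈ F' := (Finset.mem_filter.1 hu).2
    have hv' : f v ∈ Finset.range n := Finset.mem_range.2 (e v).isLt
    by_cases hvb : f v ∈ bagOf bags t
    · exact Or.inr (Finset.mem_filter.2 ⟨Finset.mem_univ _, by simpa using hvb⟩)
    · exact Or.inl (Finset.mem_filter.2 ⟨Finset.mem_univ _,
        hcl (f u) hu' (f v) hv' ⟨u, v, huv, rfl, rfl⟩ hvb⟩)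

end Treewidth

end Literature.Combinatorics.SimpleGraph
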